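import Literature.NumberTheory.EllipticCurves.UniformizationHolomorphic
import Literature.NumberTheory.Transcendental.AnalytificationSeparatedProofs
import Literature.Geometry.Kaehler.ComplexTorusCover
import Mathlib.Topology.Homeomorph.Lemmas
import HarnessLib

/-!
# One-dimensional complex tori are algebraic: `ℂ/Λ ≅ E_Λ(ℂ)` as an analytification

Lefschetz's theorem "a complex torus with a Riemann form is a projective algebraic variety"
(Lange–Birkenhake, *Complex Abelian Varieties*, Thm. 2.1.13 with Thm. 2.1.10) in DIMENSION ONE, where
it is the uniformisation of elliptic curves (Silverman, *AEC* VI Prop. 3.6 (b): `φ : ℂ/Λ → E_Λ(ℂ)`,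
`z ↦ [℘(z), ℘'(z)/2, 1]` "is a complex analytic isomorphism"; Lange–Birkenhake Cor. 2.1.14 ff.:
every one-dimensional torus is an abelian variety), in the tree's vocabulary:

* `exists_isAnalytification_complexTorus_dimOne` — **for EVERY period isomorphism
  `Φ : ℝ^ι ≃ ℂ¹` the complex torus `ComplexTorus Φ = ℂ¹/Φ(ℤ^ι)` is the analytification
  (`IsAnalytification (Fin 1 → ℂ) X 1 φ`) of a smooth projective complex curve `X`** — namely of
  the Weierstrass cubic `E_Λ` (the tree's `PeriodPair.curve`, `WeierstrassCurve.scheme`) of the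
  lattice `Λ = {(Φm)₀ : m ∈ ℤ^ι} = ℤω₀ + ℤω₁` (`|ι| = 2`), through
  `t ↦ upoint((Φ lift t)₀)` (`PeriodPair.upoint`, `EllipticCurves/UniformizationHolomorphic`).
  This is the hypothesis `hL` of
  `HodgeTheory.weightOne_polarizable_eq_range_of_smoothProjective_of_lefschetz` at `n = 1`
  (no Riemann form is needed in dimension one).

The proof is the descent argument of
`Literature/Barriers/HodgeConjecture/GeneralizedHodgeTrivialReasonsEllipticCurveCubedModel`
(`isAnalytification_torusMap`, for `E_τ³`) in one variable and for an arbitrary lattice basis: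
`DimOneTorus.cover_eq_cover_iff` (the lattice of `ComplexTorus Φ` read in `ℂ`),
`upoint_lift_cover` (`torusMap ∘ π = upoint`), injectivity / surjectivity / continuity over charts,
homeomorphism (compact onto Hausdorff), and holomorphy of pulled-back regular functions
(`PeriodPair.exists_isHolFamilyOn_upoint`).

Everything is proved; no definition, no named fact.

## References

* [SilvermanAEC2009] J. H. Silverman, The Arithmetic of Elliptic Curves (2009), VI Prop. 3.6 (b).
* [LangeBirkenhake1992] H. Lange, Ch. Birkenhake, Complex Abelian Varieties, §2.1 Thm. 2.1.10,
  Thm. 2.1.13, Cor. 2.1.14.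
* [SerreGAGA1956] J.-P. Serre, GAGA (1956), §2.
-/

noncomputable section

open CategoryTheory AlgebraicGeometry Complex Metric Set Filter
open scoped Manifold Topology
open Literature.AlgebraicGeometry.Motives Literature.AlgebraicGeometry.Motives.AlgPoints
open Literature.NumberTheory.Transcendental Literature.Geometry.Kaehler

namespace Literature.AlgebraicGeometry.HodgeTheory

namespace DimOneTorus

variable {ι : Type} [Fintype ι] (Φ : (ι → ℝ) ≃L[ℝ] (Fin 1 → ℂ)) (L : PeriodPair)

/-! ### The lattice of `ComplexTorus Φ` read in `ℂ`

Throughout, `hΛ` is the hypothesis that the lattice `Φ(ℤ^ι) ⊆ ℂ¹` is `Λ_L` in the coordinate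
`z ↦ z₀`. -/

omit [Fintype ι] in
/-- `π(w) = π(0)` iff `w₀ ∈ Λ`. [cite: LangeBirkenhake1992, §1.1.1] -/
theorem cover_eq_cover_zero_iff
    (hΛ : ∀ z : Fin 1 → ℂ, (∃ m : ι → ℤ, Φ (fun i => (m i : ℝ)) = z) ↔ z 0 ∈ L.lattice)
    (w : Fin 1 → ℂ) :
    ComplexTorus.cover Φ w = ComplexTorus.cover Φ 0 ↔ w 0 ∈ L.lattice := by
  rw [← hΛ]
  constructor
  · intro h
    have hp : ∀ p, ∃ n : ℤ, (Φ.symm w p : ℝ) = n := by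
      intro p
      have hp' := congrFun h p
      simp only [ComplexTorus.cover_apply, ComplexTorus.proj_apply, map_zero, Pi.zero_apply,
        QuotientAddGroup.mk_zero] at hp'
      obtain ⟨n, hn⟩ := (AddCircle.coe_eq_zero_iff (1 : ℝ)).mp hp'
      exact ⟨n, by rw [← hn, zsmul_eq_mul, mul_one]⟩
    choose N hN using hp
    refine ⟨N, ?_⟩
    have hw : Φ.symm w = fun p => (N p : ℝ) := funext hN
    rw [← hw, ContinuousLinearEquiv.apply_symm_apply]
  · rintro ⟨m, hm⟩
    funext p
    rw [ComplexTorus.cover_apply, ComplexTorus.cover_apply, ComplexTorus.proj_apply,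
      ComplexTorus.proj_apply, ← hm, ContinuousLinearEquiv.symm_apply_apply, map_zero,
      Pi.zero_apply, QuotientAddGroup.mk_zero, AddCircle.coe_eq_zero_iff]
    exact ⟨m p, by rw [zsmul_eq_mul, mul_one]⟩

omit [Fintype ι] in
/-- **The lattice of `ComplexTorus Φ` is `Λ`**: `π(z) = π(z')` iff `z₀ - z'₀ ∈ Λ`.
[cite: LangeBirkenhake1992, §1.1.1] -/
theorem cover_eq_cover_iff
    (hΛ : ∀ z : Fin 1 → ℂ, (∃ m : ι → ℤ, Φ (fun i => (m i : ℝ)) = z) ↔ z 0 ∈ L.lattice)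
    (z z' : Fin 1 → ℂ) :
    ComplexTorus.cover Φ z = ComplexTorus.cover Φ z' ↔ z 0 - z' 0 ∈ L.lattice := by
  have hsub : ComplexTorus.cover Φ z = ComplexTorus.cover Φ z' ↔
      ComplexTorus.cover Φ (z - z') = ComplexTorus.cover Φ 0 := by
    simp only [ComplexTorus.cover_apply, map_sub, map_zero]
    constructor
    · intro h
      funext p
      have hp := congrFun h p
      simp only [ComplexTorus.proj_apply, Pi.sub_apply, Pi.zero_apply] at hp ⊢
      rw [AddCircle.coe_sub, hp, sub_self, QuotientAddGroup.mk_zero]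
    · intro h
      funext p
      have hp := congrFun h p
      simp only [ComplexTorus.proj_apply, Pi.sub_apply, Pi.zero_apply, QuotientAddGroup.mk_zero,
        AddCircle.coe_sub, sub_eq_zero] at hp ⊢
      exact hp
  rw [hsub, cover_eq_cover_zero_iff Φ L hΛ, Pi.sub_apply]

/-! ### The comparison map `t ↦ upoint((Φ lift t)₀)` -/

omit [Fintype ι] in
/-- **`torusMap ∘ π = upoint ∘ (·)₀`** for the covering map `π = cover : ℂ¹ → T`. [folklore] -/
theorem upoint_lift_cover
    (hΛ : ∀ z : Fin 1 → ℂ, (∃ m : ι → ℤ, Φ (fun i => (m i : ℝ)) = z) ↔ z 0 ∈ L.lattice)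
    (z : Fin 1 → ℂ) :
    L.upoint (Φ (ComplexTorus.lift Φ (ComplexTorus.cover Φ z)) 0) = L.upoint (z 0) := by
  apply PeriodPair.upoint_eq_upoint_iff.mpr
  apply (cover_eq_cover_iff Φ L hΛ _ _).mp
  rw [ComplexTorus.cover_apply, ContinuousLinearEquiv.symm_apply_apply, ComplexTorus.proj_lift]

/-- **The comparison map is injective** (`upoint` is injective modulo `Λ`).
[cite: SilvermanAEC2009, VI Prop. 3.6 (b)] -/
theorem injective_torusMap
    (hΛ : ∀ z : Fin 1 → ℂ, (∃ m : ι → ℤ, Φ (fun i => (m i : ℝ)) = z) ↔ z 0 ∈ L.lattice) :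
    Function.Injective fun t : ComplexTorus Φ => L.upoint (Φ (ComplexTorus.lift Φ t) 0) := by
  intro t t' h
  obtain ⟨z, rfl⟩ := ComplexTorus.cover_surjective Φ t
  obtain ⟨z', rfl⟩ := ComplexTorus.cover_surjective Φ t'
  have h' : L.upoint (z 0) = L.upoint (z' 0) := by
    rw [← upoint_lift_cover Φ L hΛ z, ← upoint_lift_cover Φ L hΛ z']
    exact h
  exact (cover_eq_cover_iff Φ L hΛ z z').mpr (PeriodPair.upoint_eq_upoint_iff.mp h')

omit [Fintype ι] in
/-- **The comparison map is surjective** (`upoint` is). [cite: SilvermanAEC2009, VI Prop. 3.6 (b)] -/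
theorem surjective_torusMap
    (hΛ : ∀ z : Fin 1 → ℂ, (∃ m : ι → ℤ, Φ (fun i => (m i : ℝ)) = z) ↔ z 0 ∈ L.lattice) :
    Function.Surjective fun t : ComplexTorus Φ => L.upoint (Φ (ComplexTorus.lift Φ t) 0) := by
  intro Q
  obtain ⟨u, rfl⟩ := L.upoint_surjective Q
  exact ⟨ComplexTorus.cover Φ (fun _ => u), upoint_lift_cover Φ L hΛ _⟩

/-- Over the domain of a chart of the torus, the comparison map is `upoint ∘ (·)₀ ∘ chart`.
[folklore] -/
theorem upoint_chartAt
    (hΛ : ∀ z : Fin 1 → ℂ, (∃ m : ι → ℤ, Φ (fun i => (m i : ℝ)) = z) ↔ z 0 ∈ L.lattice)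
    {t s : ComplexTorus Φ} (hs : s ∈ (chartAt (Fin 1 → ℂ) t).source) :
    L.upoint (chartAt (Fin 1 → ℂ) t s 0) = L.upoint (Φ (ComplexTorus.lift Φ s) 0) := by
  have hs' : ComplexTorus.cover Φ (chartAt (Fin 1 → ℂ) t s) = s := by
    rw [ComplexTorus.chartAt_eq, ← ComplexTorus.chart_symm_eq_cover Φ (ComplexTorus.corner Φ t)]
    exact (ComplexTorus.chart Φ _).left_inv hs
  rw [← upoint_lift_cover Φ L hΛ, hs']

/-- **The comparison map is continuous**: over each chart it is `upoint ∘ (·)₀ ∘ chart`.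
[folklore] -/
theorem continuous_torusMap
    (hΛ : ∀ z : Fin 1 → ℂ, (∃ m : ι → ℤ, Φ (fun i => (m i : ℝ)) = z) ↔ z 0 ∈ L.lattice) :
    Continuous fun t : ComplexTorus Φ => L.upoint (Φ (ComplexTorus.lift Φ t) 0) := by
  refine continuous_iff_continuousAt.mpr fun t ↦ ?_
  have h0 : Continuous fun u : Fin 1 → ℂ => L.upoint (u 0) :=
    L.continuous_upoint.comp (continuous_apply 0 : Continuous fun u : Fin 1 → ℂ => u 0)
  have h1 : ContinuousAt (fun s : ComplexTorus Φ => L.upoint (chartAt (Fin 1 → ℂ) t s 0)) t :=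
    h0.continuousAt.comp ((chartAt (Fin 1 → ℂ) t).continuousAt (mem_chart_source (Fin 1 → ℂ) t))
  refine h1.congr ?_
  filter_upwards [(chartAt (Fin 1 → ℂ) t).open_source.mem_nhds (mem_chart_source (Fin 1 → ℂ) t)]
    with s hs
  exact upoint_chartAt Φ L hΛ hs

/-- **The comparison map `T → E_Λ(ℂ)` is a homeomorphism** (a continuous bijection from a compact
space onto a Hausdorff one). [cite: SilvermanAEC2009, VI Prop. 3.6 (b)] -/
theorem isHomeomorph_torusMap
    (hΛ : ∀ z : Fin 1 → ℂ, (∃ m : ι → ℤ, Φ (fun i => (m i : ℝ)) = z) ↔ z 0 ∈ L.lattice) :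
    IsHomeomorph fun t : ComplexTorus Φ => L.upoint (Φ (ComplexTorus.lift Φ t) 0) := by
  haveI : IsProper L.curve.scheme.hom :=
    IsSmoothProjective.isProper_holds L.curve.isSmoothProjective_scheme
  haveI : T2Space (ComplexPoints L.curve.scheme) := ComplexPoints.t2Space_of_isSeparated _
  exact isHomeomorph_iff_continuous_bijective.mpr
    ⟨continuous_torusMap Φ L hΛ, injective_torusMap Φ L hΛ, surjective_torusMap Φ L hΛ⟩

omit [Fintype ι] in
/-- **Regular functions on `E_Λ` pull back to holomorphic functions on `ℂ¹`** along
`u ↦ upoint(u₀)` (`upoint` is a holomorphic family near every point). [cite: SerreGAGA1956, §2 n°5] -/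
theorem differentiableOn_evalOrZero_upoint (W : L.curve.scheme.left.Opens)
    (g : Γ(L.curve.scheme.left, W)) :
    DifferentiableOn ℂ (fun u : Fin 1 → ℂ ↦ evalOrZero W g (L.upoint (u 0)))
      ((fun u : Fin 1 → ℂ => L.upoint (u 0)) ⁻¹' {Q | Q.pt ∈ W}) := by
  intro u₀ hu₀
  obtain ⟨ε, hε, hfam⟩ := L.exists_isHolFamilyOn_upoint (u₀ 0)
  have hfam' : IsHolFamilyOn ((fun u : Fin 1 → ℂ => u 0) ⁻¹' ball (u₀ 0) ε)
      (L.upoint ∘ fun u : Fin 1 → ℂ => u 0) :=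
    IsHolFamilyOn.comp (P' := Fin 1 → ℂ) hfam (fun u : Fin 1 → ℂ ↦ u 0)
      (fun u _ ↦ (differentiableAt_apply (𝕜 := ℂ) 0 u).differentiableWithinAt) (fun u hu ↦ hu)
  have hU : IsOpen ((fun u : Fin 1 → ℂ => u 0) ⁻¹' ball (u₀ 0) ε) :=
    isOpen_ball.preimage (continuous_apply 0 : Continuous fun u : Fin 1 → ℂ => u 0)
  have hd := hfam'.differentiableOn_evalOrZero hU W g
  have hopen := hfam'.isOpen_inter_preimage hU W
  exact (hd.differentiableAt (hopen.mem_nhds ⟨mem_ball_self hε, hu₀⟩)).differentiableWithinAt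

/-- **`ComplexTorus Φ` is the analytification of `E_Λ`** along `t ↦ upoint((Φ lift t)₀)`: a
homeomorphism onto `E_Λ(ℂ)`, model `ℂ¹` of dimension `1`, and regular functions on affine opens
pull back to holomorphic functions on the torus (in its charts they are `g ∘ upoint ∘ (·)₀`).
Silverman VI Prop. 3.6 (b) in the language of `IsAnalytification`.
[cite: SilvermanAEC2009, VI Prop. 3.6 (b)] [cite: SerreGAGA1956, §2 n°5] -/
theorem isAnalytification_torusMap
    (hΛ : ∀ z : Fin 1 → ℂ, (∃ m : ι → ℤ, Φ (fun i => (m i : ℝ)) = z) ↔ z 0 ∈ L.lattice) :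
    IsAnalytification (Fin 1 → ℂ) L.curve.scheme 1
      fun t : ComplexTorus Φ => L.upoint (Φ (ComplexTorus.lift Φ t) 0) where
  isHomeomorph := isHomeomorph_torusMap Φ L hΛ
  finrank_eq := by simp
  mdifferentiableOn_evalOrZero U s := by
    intro t ht
    refine MDifferentiableAt.mdifferentiableWithinAt ?_
    rw [mdifferentiableAt_iff]
    refine ⟨?_, ?_⟩
    · exact ContinuousAt.comp (f := fun m : ComplexTorus Φ => L.upoint (Φ (ComplexTorus.lift Φ m) 0))
        (g := evalOrZero (↑U) s)
        ((continuousOn_evalOrZero _ s).continuousAt ((isOpen_setOf_pt_mem _).mem_nhds ht))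
        (continuous_torusMap Φ L hΛ).continuousAt
    · have hw : writtenInExtChartAt 𝓘(ℂ, Fin 1 → ℂ) 𝓘(ℂ, ℂ) t
          (fun m ↦ evalOrZero (↑U) s (L.upoint (Φ (ComplexTorus.lift Φ m) 0))) =
          fun z ↦ evalOrZero (↑U) s (L.upoint (z 0)) := by
        funext z
        simp only [writtenInExtChartAt, extChartAt_model_space_eq_id, PartialEquiv.refl_coe,
          Function.comp_apply, id_eq]
        rw [ComplexTorus.extChartAt_symm_eq_cover, upoint_lift_cover Φ L hΛ]
      rw [hw]
      refine DifferentiableAt.differentiableWithinAt ?_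
      have hz : L.upoint ((extChartAt 𝓘(ℂ, Fin 1 → ℂ) t t) 0) =
          L.upoint (Φ (ComplexTorus.lift Φ t) 0) := by
        rw [← upoint_lift_cover Φ L hΛ, ComplexTorus.cover_extChartAt_self]
      refine (differentiableOn_evalOrZero_upoint L U s).differentiableAt (IsOpen.mem_nhds ?_ ?_)
      · exact (isOpen_setOf_pt_mem U).preimage
          (L.continuous_upoint.comp (continuous_apply 0 : Continuous fun u : Fin 1 → ℂ => u 0))
      · change (L.upoint ((extChartAt 𝓘(ℂ, Fin 1 → ℂ) t t) 0)).pt ∈ (↑U : L.curve.scheme.left.Opens)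
        rw [hz]
        exact ht

end DimOneTorus

/-! ### The theorem -/

/-- **Every one-dimensional complex torus is (the analytification of) an elliptic curve.** For
every period isomorphism `Φ : ℝ^ι ≃ ℂ¹` there are a smooth projective complex curve `X` and a
map `φ : ComplexTorus Φ → X(ℂ)` which IS the analytification of `X`: `|ι| = 2`, the lattice
`Φ(ℤ^ι)` read in `ℂ` is `ℤω₀ + ℤω₁` with `ω₀, ω₁` `ℝ`-independent (a `PeriodPair`), `X = E_Λ` its
Weierstrass cubic, `φ = upoint ∘ (Φ lift ·)₀` (Silverman VI Prop. 3.6 (b)). This is the statement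
`hL` of `weightOne_polarizable_eq_range_of_smoothProjective_of_lefschetz` (Lefschetz,
Lange–Birkenhake Thm. 2.1.13) in dimension `n = 1`. [cite: SilvermanAEC2009, VI Prop. 3.6 (b)]
[cite: LangeBirkenhake1992, §2.1 Thm. 2.1.13 and Cor. 2.1.14] -/
theorem exists_isAnalytification_complexTorus_dimOne ⦃ι : Type⦄ [Fintype ι]
    (Φ : (ι → ℝ) ≃L[ℝ] (Fin 1 → ℂ)) :
    ∃ (X : SchemeOver ℂ) (_ : IsSmoothProjective 1 X) (φ : ComplexTorus Φ → ComplexPoints X),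
      IsAnalytification (Fin 1 → ℂ) X 1 φ := by
  classical
  -- `|ι| = 2`
  have hcard : Fintype.card ι = 2 := by
    have h := Φ.toLinearEquiv.finrank_eq
    rw [Module.finrank_fintype_fun_eq_card] at h
    rw [h]
    simp [Module.finrank_pi_fintype, Complex.finrank_real_complex]
  let σ : ι ≃ Fin 2 := Fintype.equivFinOfCardEq hcard
  have hne : σ.symm 0 ≠ σ.symm 1 := fun h => by simpa using σ.symm.injective h
  -- the periods
  obtain ⟨p₀, hp₀⟩ : ∃ w : ℂ, w = Φ (Pi.single (σ.symm 0) (1 : ℝ)) 0 := ⟨_, rfl⟩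
  obtain ⟨p₁, hp₁⟩ : ∃ w : ℂ, w = Φ (Pi.single (σ.symm 1) (1 : ℝ)) 0 := ⟨_, rfl⟩
  have hsum : ∀ x : ι → ℝ, Φ x 0 = (x (σ.symm 0) : ℂ) * p₀ + (x (σ.symm 1) : ℂ) * p₁ := by
    intro x
    have hx : x = ∑ i, x i • Pi.single i (1 : ℝ) := by
      conv_lhs => rw [← Finset.univ_sum_single x]
      exact Finset.sum_congr rfl fun i _ => by rw [← Pi.single_smul', smul_eq_mul, mul_one]
    conv_lhs => rw [hx]
    rw [map_sum, Finset.sum_apply, ← Equiv.sum_comp σ.symm, Fin.sum_univ_two, hp₀, hp₁]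
    simp only [_root_.map_smul, Pi.smul_apply, Complex.real_smul]
  have indep : LinearIndependent ℝ ![p₀, p₁] := by
    refine LinearIndependent.pair_iff.mpr fun s t hst ↦ ?_
    obtain ⟨x, hx⟩ : ∃ x : ι → ℝ,
        x = s • Pi.single (σ.symm 0) (1 : ℝ) + t • Pi.single (σ.symm 1) (1 : ℝ) := ⟨_, rfl⟩
    have hx0 : x (σ.symm 0) = s := by simp [hx, hne]
    have hx1 : x (σ.symm 1) = t := by simp [hx, hne.symm]
    have hΦx : Φ x = 0 := by
      funext j
      rw [Subsingleton.elim j 0, hsum, hx0, hx1, Pi.zero_apply]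
      rw [Complex.real_smul, Complex.real_smul] at hst
      exact hst
    have hx' : x = 0 := by
      have h := congrArg Φ.symm hΦx
      rwa [ContinuousLinearEquiv.symm_apply_apply, map_zero] at h
    exact ⟨by rw [← hx0, hx', Pi.zero_apply], by rw [← hx1, hx', Pi.zero_apply]⟩
  let L : PeriodPair := ⟨p₀, p₁, indep⟩
  have hΛ : ∀ z : Fin 1 → ℂ, (∃ m : ι → ℤ, Φ (fun i => (m i : ℝ)) = z) ↔ z 0 ∈ L.lattice := by
    intro z
    rw [PeriodPair.mem_lattice]
    change (∃ m : ι → ℤ, Φ (fun i => (m i : ℝ)) = z) ↔ ∃ a b : ℤ, (a : ℂ) * p₀ + b * p₁ = z 0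
    constructor
    · rintro ⟨m, rfl⟩
      refine ⟨m (σ.symm 0), m (σ.symm 1), ?_⟩
      rw [hsum]
      push_cast
      ring
    · rintro ⟨a, b, hab⟩
      refine ⟨fun i => if i = σ.symm 0 then a else b, funext fun j => ?_⟩
      rw [Subsingleton.elim j 0, hsum, ← hab]
      simp [hne.symm]
  exact ⟨L.curve.scheme, L.curve.isSmoothProjective_scheme, _,
    DimOneTorus.isAnalytification_torusMap Φ L hΛ⟩

end Literature.AlgebraicGeometry.HodgeTheory

end
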